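import Summits.BirchSwinnertonDyer.BirchSwinnertonDyer.Theorems.SignedLowerHalvesSmallImageLowerHalfBothSignsRttCharRoadIntegralCharacter
import Literature.NumberTheory.GaloisRepresentations.WeilLAdicCharacterLocalShape
import Literature.NumberTheory.GaloisRepresentations.HeckeCharacterDictionary
import Literature.NumberTheory.GaloisRepresentations.CMTypeHeckeCharacter
import Literature.NumberTheory.GaloisRepresentations.PrimaryGeneratorHeckeCharacter
import Literature.NumberTheory.GaloisRepresentations.LocalArtinMapPinned
import Literature.NumberTheory.EllipticCurves.ZpExtensionLayersLocalSymbolProofs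
import Literature.NumberTheory.EllipticCurves.SelmerInertia
import HarnessLib

/-!
# Route `SignedLowerHalves`, crux L `SmallImageLowerHalfBothSigns` (item stmt-BirchSwinnertonDyer-23599), line `rtt_w3` —
# brick J-char of the character road: THE LOCAL SHAPE ABOVE `p` of the integral pinned character `θ = ψ_𝔭 : Γ_K → 𝒪ˣ` of JD-b

Resident INPUTS prover `bsd-inputs-honda-p1` g18 (hand on LEAD `cruxlead-stmt-BirchSwinnertonDyer-23599` g5's row J); helper
`--supports stmt-BirchSwinnertonDyer-23599`; THEOREMS ONLY, no `sorry`; closes nothing; BSD / crux L / JD / E1 / E2 are NOT proved by this.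

WHY. The data conjunct JD of the v8 research stub `stub_charRoad_ns` (glue `SmallImageRttCharRoad.psbTheta_of_charRoad`,
`…RttCharRoad.lean`) asks for an integral `p`-adic character `θ : Γ_K → GL₁(𝒪_{ℚ_p(S)})` pinned to the Grössencharakter `ψ` AWAY
from `p·𝔪` (JD-b, `exists_integralPinnedCharacter_of_isGrossencharakter`, `…RttCharRoadIntegralCharacter.lean`) together with a local
transport `j : W[p^∞] → (F/𝒪)(θ)` above `p` (row J). Row J needs to know `θ` ON THE DECOMPOSITION GROUPS ABOVE `p`, where the pinning by
Frobenius polynomials says nothing. The helper table (BRIEF-v8-g5 §4) recorded this as «not in tree». It is: the tree PROVES the local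
shape of Weil's character above `ℓ` for every algebraic Hecke character (`HeckeCharacter.HasInfinityType.weilRep_toAbsGalois_apply`,
`WeilLAdicCharacterLocalShape.lean`: local–global compatibility of class field theory at EVERY place, `LAdicCharacterLocalGlobalProofs`,
plus Serre's local algebraicity, Ch. III §2.3). This file threads that theorem through JD-b's construction:

* §1 `exists_integralPinnedCharacter_localShape_of_isGrossencharakter` — JD-b's `∃ S θ` WITH the extra clause: for every place
  `v ∋ p` prime to `𝔪`, every local Artin map `art` of `K_v` with the characterising clauses `IsLocalArtinMap` (e.g. `canonicalArtin K_v`,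
  `exists_isLocalArtinMap_holds`) and every `w ∈ W_{K_v}`,
  `θ(res_v w) = e⁻¹(ψ v)^{deg w} · ∏_{f : K_v → ℚ̄_p continuous} f(art w)^{+n_f}`, `n_f = embExponent a b (e ∘ f ∘ ι_v)` — the Hecke
  character of `ψ⁻¹` has type `(−a, −b)`, is unramified at `v`, takes the value `(ψ v)⁻¹` at a uniformiser, and `|art w|_v = q^{-deg w}`
  (`ArtinLocalGlobal.valued_artin_eq_exp_deg`, Deligne's normalisation). On the inertia group (`deg w = 0`) only the algebraic part
  `∏_f f(art w)^{n_f}` survives (`…_of_mem_inertia` form inside §3).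
* §2 `resGalOfEmb_closureEmb_eq_absGaloisRestrict` — the restriction map `resGalOfEmb (closureEmb K_v)` of the Selmer files (the one in
  JD's `j`-clause) IS `absGaloisRestrict K K_v` of the Galois-representation files (both built on `IsAlgClosed.lift`).
* §3 the consumer's case: `K` totally complex, `ψ` of type `(embType σK, embTypeConj σK)` («`ψ((α)) = σK(α)` on the ray»):
  `embExponent_embType` (`n_φ = [φ = σK]`), `prod_zpow_embExponent_embType_eq` (the algebraic part is `f₀(x)` for THE continuous
  `f₀ : K_v → ℚ̄_p` over `σK`), `exists_continuous_localEmbedding_of_forall_eq` (such an `f₀` exists when `v` is the only place above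
  `p`, e.g. `p` inert), and ★ `exists_integralPinnedCharacter_localShape_embType`: `θ(res_v w) = e⁻¹(ψ v)^{deg w} · f₀(art w)` in the
  `resGalOfEmb (closureEmb K_v)` currency of JD — on inertia `θ = f₀ ∘ art`, and at a geometric Frobenius `w` with `art w = ψ(v)`
  (`= −p` under JD's centrality clause at an inert `p`) the value is `1`: exactly the Lubin–Tate character of `K_v` for the
  uniformiser `ψ(v)` in the tree's normalisation (`coe_lubinTateChar_toAbsGalois`, `LubinTateReciprocity.lean`), which is what row J's
  curve side (`T_pW|_{Γ_{K_v}}`, Honda type `T² + p`, B4a) must be matched against.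

References: [SerreAbelianLadic1968] Ch. II §2.7, Ch. III §1.1, §2.3; [Weil1956] §1; [NeukirchANT1999] Ch. VI §5 Prop. (5.6),
Ch. VII §6 Cor. (6.14); [TateCorvallis1979] (1.4.1).
-/

set_option autoImplicit false
-- D-0017: single-problem summit, the namespace repeats the problem name by design.
set_option linter.dupNamespace false
noncomputable section

open scoped NumberField MatrixGroups Topology
open NumberField IsDedekindDomain Polynomial Field Filter
  Literature.NumberTheory.GaloisRepresentations Literature.NumberTheory.LFunctions
  Literature.NumberTheory.EllipticCurves

namespace Summit.BirchSwinnertonDyer.BirchSwinnertonDyer.Theorems.SmallImageRttCharRoad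

/-! ## §1 JD-b with the local shape above `p` -/

section LocalShape

variable {K : Type} [Field K] [NumberField K] {p : ℕ} [Fact p.Prime]

/-- The algebraic part for the NEGATED type: `∏_f f(x)^{−n_f(−a,−b)} = ∏_f f(x)^{n_f(a,b)}` (`embExponent_neg`). [folklore] -/
theorem prod_zpow_neg_embExponent_neg {v : HeightOneSpectrum (𝓞 K)} (e : PadicAlgCl p ≃+* ℂ)
    (a b : InfinitePlace K → ℤ) (x : v.adicCompletion K) :
    ∏ f : {f : v.adicCompletion K →+* PadicAlgCl p // Continuous f},
        f.1 x ^ (-HeckeCharacter.embExponent (fun w => -a w) (fun w => -b w)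
          ((e : PadicAlgCl p →+* ℂ).comp (f.1.comp (algebraMap K (v.adicCompletion K))))) =
      ∏ f : {f : v.adicCompletion K →+* PadicAlgCl p // Continuous f},
        f.1 x ^ (HeckeCharacter.embExponent a b
          ((e : PadicAlgCl p →+* ℂ).comp (f.1.comp (algebraMap K (v.adicCompletion K))))) := by
  refine Finset.prod_congr rfl fun f _ => ?_
  rw [show (fun w => -a w) = -a from rfl, show (fun w => -b w) = -b from rfl, HeckeCharacter.embExponent_neg, neg_neg]

/-- ★ **JD-b with the local shape above `p`.** For a Grössencharakter `ψ mod 𝔪` (`𝔪 ≠ 0`, type `(a,b)`) of a number field `K`, a prime `p`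
and `e : ℚ̄_p ≃ ℂ`: there are `S ⊆ ℚ̄_p` with `0 < [ℚ_p(S):ℚ_p]` and a continuous INTEGRAL character `θ : Γ_K → GL₁(𝒪_{ℚ_p(S)})` such that
(i) [JD-b verbatim] at every `v ∤ p` with `𝔪 ≰ v`, `θ` is unramified with arithmetic-Frobenius polynomial `P`, `P.map 𝒪.subtype = X − e⁻¹(ψ v)`;
(ii) [NEW: the shape above `p`] at every `v ∋ p` with `𝔪 ≰ v`, for every local Artin map `art` of `K_v` (clauses `IsLocalArtinMap`) and
every `w ∈ W_{K_v}`: `θ(res_v w)₀₀ = e⁻¹(ψ v)^{deg w} · ∏_{f : K_v → ℚ̄_p cont.} f(art w)^{embExponent a b (e∘f∘ι_v)}` (`res_v =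
absGaloisRestrict K K_v ∘ (W_{K_v} → Γ_{K_v})`). Proof: `θ` is the integral framing (§1 of `…IntegralCharacter`) of Weil's character
`weilRep` of the Hecke character `ω` of `ψ⁻¹` (type `(−a,−b)`); (ii) is the tree's `weilRep_toAbsGalois_apply` (Serre III §2.3) with
`ω(⟨art w⟩_v) = ω(ϖ_v)^{−deg w} = (ψ v)^{deg w}` (`ω` unramified at `v ∤ 𝔪`, `|art w|_v = q_v^{−deg w}`) and `−n(−a,−b) = n(a,b)`.
[cite: SerreAbelianLadic1968, Ch. III §2.3] [cite: Weil1956, §1] [cite: NeukirchANT1999, Ch. VI §5 Prop. (5.6), Ch. VII §6 Cor. (6.14)] -/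
theorem exists_integralPinnedCharacter_localShape_of_isGrossencharakter {𝔪 : Ideal (𝓞 K)}
    (h𝔪 : 𝔪 ≠ ⊥) {a b : InfinitePlace K → ℤ} {ψ : HeightOneSpectrum (𝓞 K) → ℂ} (hψ : IsGrossencharakter 𝔪 a b ψ)
    (e : PadicAlgCl p ≃+* ℂ) :
    ∃ S : Set (PadicAlgCl p), 0 < Module.finrank ℚ_[p] (padicCoeffField S) ∧
      ∃ θ : FramedGaloisRep K (padicCoeffIntegers S) 1,
        (∀ v : HeightOneSpectrum (𝓞 K), ((p : ℕ) : 𝓞 K) ∉ v.asIdeal → ¬ 𝔪 ≤ v.asIdeal →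
          θ.IsUnramifiedAt v ∧ ∃ P : Polynomial (padicCoeffIntegers S),
            P.map (padicCoeffIntegers S).subtype = X - C (e.symm (ψ v)) ∧ θ.HasFrobCharpolyAt v P) ∧
        (∀ v : HeightOneSpectrum (𝓞 K), ((p : ℕ) : 𝓞 K) ∈ v.asIdeal → ¬ 𝔪 ≤ v.asIdeal →
          ∀ (art : WeilGroup (v.adicCompletion K) →* (v.adicCompletion K)ˣ), IsLocalArtinMap (v.adicCompletion K) art →
          ∀ w : WeilGroup (v.adicCompletion K),
            ((((θ (absGaloisRestrict K (v.adicCompletion K) (WeilGroup.toAbsGalois (v.adicCompletion K) w)) :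
                GL (Fin 1) (padicCoeffIntegers S)) : Matrix (Fin 1) (Fin 1) (padicCoeffIntegers S)) 0 0 : padicCoeffIntegers S) :
                PadicAlgCl p) =
              e.symm (ψ v) ^ (WeilGroup.deg w) *
                ∏ f : {f : v.adicCompletion K →+* PadicAlgCl p // Continuous f},
                  f.1 ((art w : (v.adicCompletion K)ˣ) : v.adicCompletion K) ^
                    (HeckeCharacter.embExponent a b
                      ((e : PadicAlgCl p →+* ℂ).comp (f.1.comp (algebraMap K (v.adicCompletion K)))))) := by
  haveI : CompactSpace (absoluteGaloisGroup K) := absoluteGaloisGroup_compactSpace K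
  -- `ψ⁻¹` is a Grössencharakter mod `𝔪` of type `(-a, -b)`
  have hpow : ∀ I : Ideal (𝓞 K), idealPow K (fun v => (ψ v)⁻¹) I = (idealPow K ψ I)⁻¹ := fun I => by
    rw [idealPow, idealPow, ← finprod_inv_distrib]
    exact finprod_congr fun v => inv_pow _ _
  have hinv : IsGrossencharakter 𝔪 (fun w => -a w) (fun w => -b w) (fun v => (ψ v)⁻¹) := by
    refine ⟨fun v hv => inv_ne_zero (hψ.ne_zero v hv), fun c d hc hd hcop hcd hpos => ?_⟩
    rw [hpow, hpow, hψ.idealPow_span_eq c d hc hd hcop hcd hpos, mul_inv, ← Finset.prod_inv_distrib]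
    refine congrArg _ (Finset.prod_congr rfl fun w _ => ?_)
    rw [mul_inv, zpow_neg, zpow_neg]
  -- the idelic lift `ω` of `ψ⁻¹`, its module of definition, Weil's character `r = weilRep`
  obtain ⟨ω, hinf, hω⟩ := HeckeCharacter.exists_of_isGrossencharakter h𝔪 hinv
  obtain ⟨ex, hmod⟩ := ω.exists_isModulus_of_ramified
  set T := (HeckeCharacter.finite_ramifiedPlaces_holds ω).toFinset with hT
  have hTunr : ∀ w : HeightOneSpectrum (𝓞 K), w ∉ T → ω.IsUnramifiedAt w := fun w hw => by
    by_contra hh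
    exact hw ((HeckeCharacter.finite_ramifiedPlaces_holds ω).mem_toFinset.mpr hh)
  set S := HeckeCharacter.lAdicValueGens ω e T ex with hS
  haveI hfd : FiniteDimensional ℚ_[p] (padicCoeffField S) := HeckeCharacter.finiteDimensional_lAdicValueField ω e T ex
  -- the values of Weil's character lie in the (closed) field of values
  have hclosed : IsClosed ((padicCoeffField S : IntermediateField ℚ_[p] (PadicAlgCl p)) : Set (PadicAlgCl p)) :=
    (HeckeCharacter.isComplete_lAdicValueField ω e T ex).isClosed
  have hval : ∀ σ : absoluteGaloisGroup K, hinf.weilValue hmod e σ ∈ padicCoeffField S := fun σ =>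
    hclosed.mem_of_tendsto (hinf.tendsto_rep hmod e σ) (Eventually.of_forall fun N => hinf.rep_mem hmod e N σ)
  have hmem : ∀ σ : absoluteGaloisGroup K,
      ((hinf.weilRep hmod e σ : GL (Fin 1) (PadicAlgCl p)) : Matrix (Fin 1) (Fin 1) (PadicAlgCl p)) 0 0 ∈ padicCoeffField S := fun σ => by
    rw [hinf.weilRep_apply_coe hmod e σ 0 0]
    exact inv_mem (hval σ)
  obtain ⟨θ, hθ⟩ := FramedRep.exists_baseChange_eq_of_forall_mem (hinf.weilRep hmod e) S hmem
  refine ⟨S, Module.finrank_pos, θ, fun v hvp hv => ?_, fun v hvp hv art hart w => ?_⟩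
  · -- (i) JD-b verbatim
    obtain ⟨hunr, hvalv⟩ := hω v hv
    have hvT : v ∉ T := fun h => ((HeckeCharacter.finite_ramifiedPlaces_holds ω).mem_toFinset.mp h) hunr
    have h1 := hinf.isUnramifiedAt_weilRep hmod e hvT hvp
    have h2 := hinf.hasFrobCharpolyAt_weilRep hmod e hvT hvp
    rw [hvalv] at h2
    rw [← hθ] at h1 h2
    simp only [inv_inv] at h2
    refine ⟨(FramedGaloisRep.isUnramifiedAt_baseChange_iff _ _ Subtype.val_injective v θ).mp h1, ?_⟩
    obtain ⟨𝔓, h𝔓⟩ := IsDedekindDomain.HeightOneSpectrum.primesAbove_nonempty v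
    obtain ⟨Φ, hΦ⟩ := IsDedekindDomain.HeightOneSpectrum.exists_isArithFrobAt_of_mem_primesAbove_holds h𝔓
    have hentry := (FramedGaloisRep.hasFrobCharpolyAt_iff_of_rank_one _ v _).mp h2 𝔓 h𝔓 Φ hΦ
    rw [FramedRep.coe_baseChange_apply, Matrix.map_apply] at hentry
    refine ⟨X - C (((θ Φ : GL (Fin 1) (padicCoeffIntegers S)) : Matrix (Fin 1) (Fin 1) (padicCoeffIntegers S)) 0 0), ?_, ?_⟩
    · rw [Polynomial.map_sub, map_X, map_C, hentry]
    · refine (FramedGaloisRep.hasFrobCharpolyAt_baseChange_iff (padicCoeffIntegers S).subtype continuous_subtype_val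
        Subtype.val_injective v θ _).mp ?_
      rw [Polynomial.map_sub, map_X, map_C, hentry]
      exact h2
  · -- (ii) the local shape above `p`
    obtain ⟨hunr, hvalv⟩ := hω v hv
    have key := hinf.weilRep_toAbsGalois_apply hmod e hTunr hvp art hart w
    rw [← hθ, FramedRep.coe_baseChange_apply, Matrix.map_apply] at key
    rw [Subring.coe_subtype] at key
    rw [key, prod_zpow_neg_embExponent_neg e a b]
    congr 1
    -- `ω(⟨art w⟩_v) = ω(ϖ_v)^{-deg w} = (ψ v)^{deg w}`
    have hz : Valued.v ((art w : (v.adicCompletion K)ˣ) : v.adicCompletion K) = WithZero.exp (-(-WeilGroup.deg w)) := by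
      rw [neg_neg]; exact ArtinLocalGlobal.valued_artin_eq_exp_deg v hart w
    rw [hunr.coe_map_localUnits_eq_zpow (art w) hz, hvalv, map_zpow₀, map_inv₀, inv_zpow', neg_neg]

end LocalShape

/-! ## §2 The two restriction maps `Γ_{K_v} → Γ_K` of the tree coincide -/

section Restrict

variable {K : Type} [Field K] (E : Type) [Field E] [Algebra K E]

/-- `resGalOfEmb (closureEmb E) = absGaloisRestrict K E` pointwise: both are the restriction along Mathlib's chosen embedding
`IsAlgClosed.lift : K̄ → Ē` (`closureEmb` of `EllipticCurves/Sha.lean` and `absClosureEmbedding` of `AbsGaloisGroup.lean` are the same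
term), characterised by `ι (res σ • x) = σ • ι x` (`resGalOfEmb_eq_of_apply_eq`, `absGaloisRestrict_apply_smul`). [folklore] -/
theorem resGalOfEmb_closureEmb_eq_absGaloisRestrict (σ : absoluteGaloisGroup E) :
    resGalOfEmb (closureEmb (K := K) E) σ = absGaloisRestrict K E σ :=
  resGalOfEmb_eq_of_apply_eq _ fun x => absGaloisRestrict_apply_smul K E σ x

end Restrict

/-! ## §3 The consumer's case: type `(embType σK, embTypeConj σK)`, one continuous embedding over `σK` -/

section EmbType

variable {K : Type} [Field K] [NumberField K] {p : ℕ} [Fact p.Prime]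

omit [NumberField K] in
/-- `conjugate (conjugate φ) = φ`. [folklore] -/
theorem conjugate_conjugate (φ : K →+* ℂ) : ComplexEmbedding.conjugate (ComplexEmbedding.conjugate φ) = φ := by
  ext x
  rw [ComplexEmbedding.conjugate_coe_eq, ComplexEmbedding.conjugate_coe_eq, starRingEnd_self_apply]

omit [NumberField K] in
/-- In a totally complex field no complex embedding is real. [folklore] -/
theorem not_isReal_of_isTotallyComplex [IsTotallyComplex K] (φ : K →+* ℂ) : ¬ ComplexEmbedding.IsReal φ := fun hφ =>
  (InfinitePlace.not_isReal_iff_isComplex.mpr (IsTotallyComplex.isComplex (InfinitePlace.mk φ))) ⟨φ, hφ, rfl⟩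

omit [NumberField K] in
open scoped Classical in
/-- **The exponents of the type `(embType σK, embTypeConj σK)`** («`ψ((α)) = σK(α)`»): for a non-real embedding `φ`, `n_φ = 1` if
`φ = σK` and `n_φ = 0` otherwise (at the place of `φ` the chosen embedding is `φ` or `φ̄`; in the second case the `q`-slot of `φ̄` is
read, which is `[conj φ̄ = σK] = [φ = σK]` unless `φ̄ = σK`, impossible together with `φ = σK` for non-real `φ`). [folklore] -/
theorem embExponent_embType {σK φ : K →+* ℂ} (hφ : ¬ ComplexEmbedding.IsReal φ) :
    HeckeCharacter.embExponent (embType σK) (embTypeConj σK) φ = if φ = σK then 1 else 0 := by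
  have hne1 : ¬ φ = ComplexEmbedding.conjugate φ := fun h => hφ (ComplexEmbedding.isReal_iff.mpr h.symm)
  unfold HeckeCharacter.embExponent embType embTypeConj
  rw [if_neg hφ]
  rcases NumberField.InfinitePlace.embedding_mk_eq φ with h | h
  · rw [h, if_pos rfl]
  · rw [h, if_neg hne1, conjugate_conjugate]
    by_cases h3 : ComplexEmbedding.conjugate φ = σK
    · have hne : ¬ φ = σK := fun h4 => hφ (ComplexEmbedding.isReal_iff.mpr (h3.trans h4.symm))
      rw [if_pos h3, if_neg hne]
    · rw [if_neg h3]

/-- **The algebraic part for the type `(embType σK, embTypeConj σK)` is `f₀(x)`**, where `f₀ : K_v → ℚ̄_p` is THE continuous embedding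
with `e ∘ f₀ ∘ ι_v = σK` (`K` totally complex; two continuous embeddings agreeing on `K` are equal, `PadicEmbedding.eq_of_comp_algebraMap_eq`).
[folklore] -/
theorem prod_zpow_embExponent_embType_eq [IsTotallyComplex K] {v : HeightOneSpectrum (𝓞 K)} (e : PadicAlgCl p ≃+* ℂ)
    (σK : K →+* ℂ) {f₀ : v.adicCompletion K →+* PadicAlgCl p} (hf₀ : Continuous f₀)
    (hf₀σ : (e : PadicAlgCl p →+* ℂ).comp (f₀.comp (algebraMap K (v.adicCompletion K))) = σK) (x : v.adicCompletion K) :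
    ∏ f : {f : v.adicCompletion K →+* PadicAlgCl p // Continuous f},
        f.1 x ^ (HeckeCharacter.embExponent (embType σK) (embTypeConj σK)
          ((e : PadicAlgCl p →+* ℂ).comp (f.1.comp (algebraMap K (v.adicCompletion K))))) = f₀ x := by
  classical
  rw [Finset.prod_eq_single (⟨f₀, hf₀⟩ : {f : v.adicCompletion K →+* PadicAlgCl p // Continuous f})]
  · rw [embExponent_embType (not_isReal_of_isTotallyComplex _)]
    simp only [hf₀σ, if_true, zpow_one]
  · intro f _ hne
    rw [embExponent_embType (not_isReal_of_isTotallyComplex _)]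
    have hfσ : ¬ (e : PadicAlgCl p →+* ℂ).comp (f.1.comp (algebraMap K (v.adicCompletion K))) = σK := by
      intro hfσ
      apply hne
      have hcomp : f.1.comp (algebraMap K (v.adicCompletion K)) = f₀.comp (algebraMap K (v.adicCompletion K)) := by
        refine RingHom.ext fun y => e.injective ?_
        have h1 := RingHom.congr_fun hfσ y
        have h2 := RingHom.congr_fun hf₀σ y
        simp only [RingHom.coe_comp, RingHom.coe_coe, Function.comp_apply] at h1 h2 ⊢
        rw [h1, h2]
      exact Subtype.ext (PadicEmbedding.eq_of_comp_algebraMap_eq f.2 hf₀ hcomp)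
    simp only [hfσ, if_false, zpow_zero]
  · intro h
    exact absurd (Finset.mem_univ _) h

/-- **A continuous local embedding over a given complex embedding**, at the unique place above `p`: if `v` is the only place of `K`
above `p` (e.g. `p` inert), then for every `σK : K → ℂ` there is a continuous `f₀ : K_v → ℚ̄_p` with `e ∘ f₀ ∘ ι_v = σK` — the
continuous extension `PadicEmbedding.lift` of `e⁻¹ ∘ σK` to the completion at its place, which is `v`.
[cite: SerreAbelianLadic1968, Ch. II §3.1] -/
theorem exists_continuous_localEmbedding_of_forall_eq {v : HeightOneSpectrum (𝓞 K)}
    (hv : ∀ w : HeightOneSpectrum (𝓞 K), ((p : ℕ) : 𝓞 K) ∈ w.asIdeal → w = v) (e : PadicAlgCl p ≃+* ℂ) (σK : K →+* ℂ) :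
    ∃ f₀ : v.adicCompletion K →+* PadicAlgCl p, Continuous f₀ ∧
      (e : PadicAlgCl p →+* ℂ).comp (f₀.comp (algebraMap K (v.adicCompletion K))) = σK := by
  set τ : K →+* PadicAlgCl p := (e.symm : ℂ →+* PadicAlgCl p).comp σK with hτ
  obtain rfl := hv _ (PadicEmbedding.natCast_mem_place τ)
  refine ⟨PadicEmbedding.lift τ, PadicEmbedding.continuous_lift τ, RingHom.ext fun y => ?_⟩
  simp only [RingHom.coe_comp, RingHom.coe_coe, Function.comp_apply]
  rw [PadicEmbedding.lift_algebraMap, hτ, RingHom.comp_apply, RingHom.coe_coe, RingEquiv.apply_symm_apply]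

/-- ★ **The local shape above `p` of JD-b's character, in the consumer's currency.** `K` totally complex, `ψ` a Grössencharakter
`mod 𝔪 ≠ 0` of type `(embType σK, embTypeConj σK)` (the binder `IsGrossencharakter 𝔪 (embType σK) (embTypeConj σK) ψ` of JD),
`e : ℚ̄_p ≃ ℂ`: there are `S` with `0 < [ℚ_p(S):ℚ_p]` and an integral `θ : Γ_K → GL₁(𝒪_{ℚ_p(S)})` with JD-b's pinning off `p·𝔪`, AND for
every `v ∋ p` with `𝔪 ≰ v`, every continuous `f₀ : K_v → ℚ̄_p` over `σK`, every local Artin map `art` of `K_v` and every `w ∈ W_{K_v}`: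
`θ(resGalOfEmb (closureEmb K_v) w)₀₀ = e⁻¹(ψ v)^{deg w} · f₀(art w)`.
So `θ|_{Γ_{K_v}}` is `f₀ ∘ art` on inertia and takes the value `1` at any geometric Frobenius `w` (`deg w = −1`) with
`f₀(art w) = e⁻¹(ψ v)` — the Lubin–Tate character of `K_v` for the uniformiser `ψ(v)` (tree `coe_lubinTateChar_toAbsGalois`), the target
of row J's curve side. [cite: SerreAbelianLadic1968, Ch. III §2.3] [cite: Weil1956, §1] [cite: NeukirchANT1999, Ch. VII §6 Cor. (6.14)] -/
theorem exists_integralPinnedCharacter_localShape_embType [IsTotallyComplex K] {𝔪 : Ideal (𝓞 K)} (h𝔪 : 𝔪 ≠ ⊥)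
    (σK : K →+* ℂ) {ψ : HeightOneSpectrum (𝓞 K) → ℂ} (hψ : IsGrossencharakter 𝔪 (embType σK) (embTypeConj σK) ψ)
    (e : PadicAlgCl p ≃+* ℂ) :
    ∃ S : Set (PadicAlgCl p), 0 < Module.finrank ℚ_[p] (padicCoeffField S) ∧
      ∃ θ : FramedGaloisRep K (padicCoeffIntegers S) 1,
        (∀ v : HeightOneSpectrum (𝓞 K), ((p : ℕ) : 𝓞 K) ∉ v.asIdeal → ¬ 𝔪 ≤ v.asIdeal →
          θ.IsUnramifiedAt v ∧ ∃ P : Polynomial (padicCoeffIntegers S),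
            P.map (padicCoeffIntegers S).subtype = X - C (e.symm (ψ v)) ∧ θ.HasFrobCharpolyAt v P) ∧
        (∀ v : HeightOneSpectrum (𝓞 K), ((p : ℕ) : 𝓞 K) ∈ v.asIdeal → ¬ 𝔪 ≤ v.asIdeal →
          ∀ (f₀ : v.adicCompletion K →+* PadicAlgCl p), Continuous f₀ →
            (e : PadicAlgCl p →+* ℂ).comp (f₀.comp (algebraMap K (v.adicCompletion K))) = σK →
          ∀ (art : WeilGroup (v.adicCompletion K) →* (v.adicCompletion K)ˣ), IsLocalArtinMap (v.adicCompletion K) art →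
          ∀ w : WeilGroup (v.adicCompletion K),
            ((((θ (resGalOfEmb (closureEmb (K := K) (v.adicCompletion K)) (WeilGroup.toAbsGalois (v.adicCompletion K) w)) :
                GL (Fin 1) (padicCoeffIntegers S)) : Matrix (Fin 1) (Fin 1) (padicCoeffIntegers S)) 0 0 : padicCoeffIntegers S) :
                PadicAlgCl p) =
              e.symm (ψ v) ^ (WeilGroup.deg w) * f₀ ((art w : (v.adicCompletion K)ˣ) : v.adicCompletion K)) := by
  obtain ⟨S, hS, θ, hpin, hloc⟩ := exists_integralPinnedCharacter_localShape_of_isGrossencharakter h𝔪 hψ e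
  refine ⟨S, hS, θ, hpin, fun v hvp hv f₀ hf₀ hf₀σ art hart w => ?_⟩
  rw [resGalOfEmb_closureEmb_eq_absGaloisRestrict, hloc v hvp hv art hart w, prod_zpow_embExponent_embType_eq e σK hf₀ hf₀σ]

end EmbType

end Summit.BirchSwinnertonDyer.BirchSwinnertonDyer.Theorems.SmallImageRttCharRoad

end
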